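import Literature.Algebra.EuclideanLattices.LatticeComplexity
import Literature.Algebra.EuclideanLattices.PQCLLLPolyTime
import Literature.Computability.Complexity.BrickAlgebra
import Literature.Computability.Cryptography.ClassBQPComplementProofs
import HarnessLib

/-!
# Regev 2004, Thm. 1.1 (a DCP solution yields quantum unique-SVP): the LLL pre-processing step

Topic `Algebra/EuclideanLattices` (family `pqc`), sibling of `LatticeComplexity.lean`; proved
material towards the discharge of the named fact
`Literature.Algebra.EuclideanLattices.usvp_of_dihedralCoset` (**pqc.S28**; Regev, *Quantum
computation and lattice problems*, SIAM J. Comput. 33 (2004), Thm. 1.1). No named fact is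
introduced here.

Regev's algorithm (§3) begins by LLL-reducing the input basis (§3.2, p. 6: "Such a basis can be
found for any lattice by using a polynomial time algorithm"; first sentence of the proofs of
Lemmas 3.4 and 3.12, pp. 8 and 14), and everything after that step works on the reduced basis.
This file proves, in the tree's model (poly-time uniform, oracle-free Clifford+T families measured
on all wires, `QCircuitFamily.kernelProb`), that this first step can be hoisted:
**`usvp_of_dihedralCoset_of_lllReduced`** — if the conclusion of `usvp_of_dihedralCoset` holds
for inputs that are LLL-reduced with `δ = 3/4`, it holds for all inputs. The proof feeds the
tree's proved closure of bounded-error quantum search under classical polynomial-time pre- and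
post-processing (`isQSolvable_classicalWrap_holds`, Bernstein–Vazirani 1997, §8) with the proved
polynomial-time LLL string function `LLLMachine.lllMachineF` (LLL82 Prop. 1.26:
`lllMachineF_mem_FP`, `lllMachineF_encode`, `LatticeInstance.lllReduce_eq_capRun`,
`lllReduce_lattice`, `lll_halts_within_holds`, `isLLLReduced_of_halted_holds`; packaged as
`exists_lllMachineF_encode_eq`) and transports the promise and the solution set along
`L(B') = L(B)` (`LatticeInstance.isNonsingular_of_lattice_eq`, `usvpPromise_of_lattice_eq`,
`usvpOutputs_eq_of_lattice_eq`).

## References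

* O. Regev, *Quantum computation and lattice problems*, SIAM J. Comput. 33 (2004) 738–760,
  Thm. 1.1, §3.2 (p. 6), proofs of Lemma 3.4 (p. 8) and Lemma 3.12 (p. 14).
* A. K. Lenstra, H. W. Lenstra Jr., L. Lovász, Math. Ann. 261 (1982), Prop. 1.26.
* E. Bernstein, U. Vazirani, *Quantum complexity theory*, SIAM J. Comput. 26 (1997), §8.
-/

noncomputable section

namespace Literature.Algebra.EuclideanLattices

open _root_.Computability Literature.Computability.Complexity Literature.Computability.Cryptography

/-! ### Transport along equality of lattices -/

namespace LatticeInstance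

/-- A basis matrix generating the same lattice as a nonsingular one is nonsingular: its `n`
rows span `ℝⁿ` (they generate a full-rank lattice), hence are linearly independent.
[Micciancio–Goldwasser 2002, Ch. 1, Def. 1.1 (bases of the same lattice)] [folklore] -/
theorem isNonsingular_of_lattice_eq {I : LatticeInstance} (hI : I.IsNonsingular)
    {B' : Matrix (Fin I.n) (Fin I.n) ℤ} (h : (⟨I.n, B'⟩ : LatticeInstance).lattice = I.lattice) :
    (⟨I.n, B'⟩ : LatticeInstance).IsNonsingular := by
  set I' : LatticeInstance := ⟨I.n, B'⟩ with hI'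
  rw [isNonsingular_iff_linearIndependent]
  refine linearIndependent_of_top_le_span_of_card_eq_finrank ?_ (by simp)
  -- `ℝⁿ = span_ℝ (rows of B) ≤ span_ℝ (rows of B')` since every row of `B` lies in `L(B) = L(B')`
  have htop : (⊤ : Submodule ℝ (EuclideanSpace ℝ (Fin I.n))) ≤
      Submodule.span ℝ (Set.range I.vec) := by
    rw [← (basisOfIsNonsingular hI).span_eq, coe_basisOfIsNonsingular]
  refine htop.trans (Submodule.span_le.2 ?_)
  rintro _ ⟨i, rfl⟩
  have hi : I.vec i ∈ I'.lattice := by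
    rw [h]
    exact Submodule.subset_span ⟨i, rfl⟩
  exact Submodule.span_subset_span ℤ ℝ _ hi

end LatticeInstance

/-- The `uSVP` promise depends on the instance only through its dimension and its lattice.
[Regev 2009, §1 (uSVP is a property of the lattice)] [folklore] -/
theorem usvpPromise_of_lattice_eq {γ : ℕ → ℝ} {I : LatticeInstance} (hI : USVP.Promise γ I)
    {B' : Matrix (Fin I.n) (Fin I.n) ℤ} (h : (⟨I.n, B'⟩ : LatticeInstance).lattice = I.lattice) :
    USVP.Promise γ ⟨I.n, B'⟩ := by
  refine ⟨LatticeInstance.isNonsingular_of_lattice_eq hI.1 h, ?_⟩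
  have h2 := hI.2
  change γ I.n * minNorm (⟨I.n, B'⟩ : LatticeInstance).lattice ≤
    successiveMinimum (⟨I.n, B'⟩ : LatticeInstance).lattice 2
  rwa [h]

/-- The solution set of `uSVP` (shortest nonzero vectors, in coordinates) depends on the instance
only through its dimension and its lattice. [Regev 2009, §1] [folklore] -/
theorem usvpIsSolution_iff_of_lattice_eq {I : LatticeInstance} {B' : Matrix (Fin I.n) (Fin I.n) ℤ}
    (h : (⟨I.n, B'⟩ : LatticeInstance).lattice = I.lattice) (v : Fin I.n → ℤ) :
    USVP.IsSolution ⟨I.n, B'⟩ v ↔ USVP.IsSolution I v := by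
  change v ≠ 0 ∧ intVecToEuclidean I.n v ∈ (⟨I.n, B'⟩ : LatticeInstance).lattice ∧
      ‖intVecToEuclidean I.n v‖ = minNorm (⟨I.n, B'⟩ : LatticeInstance).lattice ↔ _
  rw [h]
  rfl

/-- Hence the output event `usvpOutputs` is the same for two bases of the same lattice.
[Regev 2009, §1] [folklore] -/
theorem usvpOutputs_eq_of_lattice_eq {I : LatticeInstance} {B' : Matrix (Fin I.n) (Fin I.n) ℤ}
    (h : (⟨I.n, B'⟩ : LatticeInstance).lattice = I.lattice) :
    usvpOutputs ⟨I.n, B'⟩ = usvpOutputs I := by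
  ext w
  change (∃ v : Fin I.n → ℤ, USVP.IsSolution ⟨I.n, B'⟩ v ∧ encodeIntVec ⟨I.n, v⟩ <+: w) ↔
    ∃ v : Fin I.n → ℤ, USVP.IsSolution I v ∧ encodeIntVec ⟨I.n, v⟩ <+: w
  simp only [usvpIsSolution_iff_of_lattice_eq h]

/-! ### The LLL pre-processor as a polynomial-time string function -/

/-- **LLL82 Prop. 1.26 in the form consumed here**: the `FP` string function `lllMachineF`
(`LLLMachineMain.lean`) maps the code of a nonsingular instance `⟨n, B⟩` to the code of an
instance `⟨n, B'⟩` of the same dimension generating the same lattice whose rows are LLL-reduced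
with `δ = 3/4` (assembled from `lllMachineF_encode`, `LatticeInstance.lllReduce_eq_capRun`,
`lllReduce_lattice`, `lll_halts_within_holds`, `isLLLReduced_of_halted_holds`).
[cite: LenstraLenstraLovasz1982, Prop. 1.26] -/
theorem exists_lllMachineF_encode_eq {I : LatticeInstance} (hI : I.IsNonsingular) :
    ∃ B' : Matrix (Fin I.n) (Fin I.n) ℤ,
      LLLMachine.lllMachineF I.encode = (⟨I.n, B'⟩ : LatticeInstance).encode ∧
      (⟨I.n, B'⟩ : LatticeInstance).lattice = I.lattice ∧
      IsLLLReduced (3 / 4) (⟨I.n, B'⟩ : LatticeInstance).vec := by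
  refine ⟨I.lllReduce.basis, ?_, I.lllReduce_lattice, ?_⟩
  · rw [LLLMachine.lllMachineF_encode, ← I.lllReduce_eq_capRun hI]
    rfl
  · -- reducedness of the output of LLL82's algorithm: loop invariant at the halted iterate
    set φ := (intVecToEuclidean I.n).toAddMonoidHom with hφ
    have hli : LinearIndependent ℝ (⇑(intVecToEuclidean I.n) ∘ I.basis) :=
      LatticeInstance.linearIndependent_vec hI
    set B : ℝ := ∑ i, ‖intVecToEuclidean I.n (I.basis i)‖ ^ 2 with hB
    have hBi : ∀ i, ‖intVecToEuclidean I.n (I.basis i)‖ ^ 2 ≤ B := fun i =>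
      Finset.single_le_sum (f := fun i => ‖intVecToEuclidean I.n (I.basis i)‖ ^ 2)
        (fun j _ => sq_nonneg _) (Finset.mem_univ i)
    have hhalted := lll_halts_within_holds (3 / 4) B I.basis (by norm_num) (by norm_num) hli hBi
    have hinv := isLLLReduced_of_halted_holds φ (3 / 4) I.basis _ hhalted
    rw [← lllResult_eq_of_halted φ hhalted] at hinv
    exact hinv

/-! ### The LLL pre-processing step -/

/-- **The LLL pre-processing step of Regev's algorithm** (Thm. 1.1 from its LLL-reduced case). If,
from a DCP solution with failure parameter `f`, some oracle-free polynomial-time uniform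
Clifford+T family solves `Θ(n^{1/2+2f})`-unique-SVP with probability `≥ 2/3` on every nonsingular
integer basis of dimension `≥ 2` that is *LLL-reduced with `δ = 3/4`* (the hypothesis `hT`:
literally the conclusion of `usvp_of_dihedralCoset` with the extra hypothesis
`IsLLLReduced (3/4) I.vec`), then `usvp_of_dihedralCoset` holds. The family for arbitrary inputs
first computes an LLL-reduced basis `B'` of `L(B)` by the polynomial-time string function
`lllMachineF` (LLL82 Prop. 1.26, proved in the tree), runs the given family on its code and copies
the output to the front — the tree's proved closure of bounded-error quantum search under
classical polynomial-time pre- and post-processing (`isQSolvable_classicalWrap_holds` with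
`h = lllMachineF`, `g = sndF`); `⟨n, B'⟩` has the same dimension and lattice, hence satisfies the
same promise (`usvpPromise_of_lattice_eq`) and has the same shortest vectors
(`usvpOutputs_eq_of_lattice_eq`), and prefixes compose.
[cite: Regev2004, Thm. 1.1 with §3.2 p. 6 and pp. 8, 14 (the LLL step)] -/
theorem usvp_of_dihedralCoset_of_lllReduced
    (hT : ∀ f : ℝ, 0 < f → DCP.HasSolution f →
      ∃ c : ℝ, 0 < c ∧ ∃ F : QCircuitFamily cliffordT, F.IsOracleFree ∧ F.IsUniform ∧
        ∀ I : LatticeInstance, 2 ≤ I.n → IsLLLReduced (3 / 4) I.vec →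
          USVP.Promise (fun n => c * (n : ℝ) ^ (1 / 2 + 2 * f)) I →
            (2 / 3 : ℝ) ≤ F.kernelProb 0 I.encode (usvpOutputs I)) :
    usvp_of_dihedralCoset := by
  intro f hf hDCP
  obtain ⟨c, hc, F, hFfree, hFunif, hF⟩ := hT f hf hDCP
  refine ⟨c, hc, ?_⟩
  set γ : ℕ → ℝ := fun n => c * (n : ℝ) ^ (1 / 2 + 2 * f) with hγ
  -- the search relation solved by `F`: on codes of reduced promise instances, `usvpOutputs`
  set R : List Bool → Set (List Bool) := fun w =>
    {y | ∀ I : LatticeInstance, w = I.encode → 2 ≤ I.n → IsLLLReduced (3 / 4) I.vec →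
      USVP.Promise γ I → y ∈ usvpOutputs I} with hRdef
  have hsub : ∀ I : LatticeInstance, usvpOutputs I ⊆ R I.encode := by
    intro I y hy I' hI' _ _ _
    cases LatticeInstance.encode_injective hI'
    exact hy
  -- `F` solves `R` with probability `≥ 2/3` on every input
  have hR : IsQSolvable R := by
    refine ⟨F, hFfree, hFunif, fun w => ?_⟩
    by_cases hw : ∃ I : LatticeInstance, w = I.encode ∧ 2 ≤ I.n ∧ IsLLLReduced (3 / 4) I.vec ∧
        USVP.Promise γ I
    · obtain ⟨I, rfl, hn, hred, hprom⟩ := hw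
      exact (hF I hn hred hprom).trans (F.kernelProb_mono 0 _ (hsub I))
    · have huniv : R w = Set.univ := by
        refine Set.eq_univ_of_forall fun y I hI hn hred hprom => ?_
        exact absurd ⟨I, hI, hn, hred, hprom⟩ hw
      rw [huniv, F.kernelProb_univ_eq_one]
      norm_num
  -- classical pre-processing by LLL and trivial post-processing
  obtain ⟨F', hF'free, hF'unif, hF'⟩ :=
    isQSolvable_classicalWrap_holds LLLMachine.lllMachineF Brick.sndF
      LLLMachine.lllMachineF_mem_FP Brick.sndF_mem_FP hR
  refine ⟨F', hF'free, hF'unif, fun I hn hprom => ?_⟩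
  refine (hF' I.encode).trans (F'.kernelProb_mono 0 _ ?_)
  -- the wrapped event is contained in `usvpOutputs I`
  rintro z ⟨y, hy, hyz⟩
  rw [Brick.sndF_boolPair] at hyz
  obtain ⟨B', hB', hlat, hred⟩ := exists_lllMachineF_encode_eq hprom.1
  have hy' : y ∈ usvpOutputs (⟨I.n, B'⟩ : LatticeInstance) :=
    hy ⟨I.n, B'⟩ hB' hn hred (usvpPromise_of_lattice_eq hprom hlat)
  rw [usvpOutputs_eq_of_lattice_eq hlat] at hy'
  obtain ⟨v, hv, hvy⟩ := hy'
  exact ⟨v, hv, hvy.trans hyz⟩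

end Literature.Algebra.EuclideanLattices

end
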